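import Summits.QuantumFields.BalabanUV.Beta.D1BFx.ScaleLegTermBound
import Summits.QuantumFields.BalabanUV.Beta.D1BFx.ScaleLegByParts

/-!
# `BalabanUV.Beta.D1BFx.ScaleLegBubbles` — road «BF-x» for binder row D1, «A3.c ∕ L-X TAILS» part (D): THE TWO-REGIME DECAY THEOREM —
# a graded bubble of total grading `≥ 3` through a scale-`n` profile obeying the END's rows d0∕d1∕h0∕h1 has second-moment full sums bounded
# UNIFORMLY IN `n` (an3's `sum_abs_moment_le ∘ isO_seven` with the budget `DG 3 2` replaced by the road's displayed rows; NO shell row, NO d3)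

HONEST DEPENDENCY (page 1, mandatory): continuum YM on T⁴ ⇐ BetaPertH ∧ nine spine estimates (0/9 proved); BetaPertH ⇐ (D1) ∧ (D4) ∧
CAP+tail; G-an2-4 gates asym, D1 and NE2/3/4.  HONEST FRAMING (cell contract, verbatim): «discharging `BetaPertH` makes Bałaban's UV
stability UNCONDITIONAL — a real constructive-QFT result; it is NOT the continuum limit and NOT the Clay problem.»  THIS MODULE DISCHARGES
NOTHING of the wall: [folklore] composition BY NAME of parts (A) `GradedBubbleTerms.exists_eterms_of_graded` (the term list), (C2)
`ScaleLegTermBound.exists_bound_weight_eval`∕`summable_weight_eval` (one admissible term), (C3) `ScaleLegByParts.tsum_weight_eval_nil_cons`∕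
`_cons_nil` (the one summation by parts on the (0,k)∕(k,0) terms), `WindowIdentification` (`fullSum_add`, `fullSum_eq_tsum_sub`).  The profile `g`
is an ARBITRARY function under the four rows; nothing about Bałaban's kernels is asserted; no `def`, no `Prop` minted, nothing cited, 0 sorry.
0 wall binders; NOT the L-X row (part (E)), NOT A3.c, NOT (K), NOT D1, NOT `BetaPertH`, NOT continuum, NOT Clay.

ABSOLUTE RULE (cell charter, verbatim): «No internally-minted statement may enter as a cited fact. Every hypothesis is either kernel-proved in
this package or a verbatim quotation of a PUBLISHED theorem with page reference. The manuscript(s) under audit are NOT citable for their own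
disputed steps — they are the thing under adjudication; programme-internal (2001/route/tribunal) claims are never citable.»

WHY (owner d1-p2-g9 RULINGS ρ-g9-31 (β) ∕ ρ-g9-32 «keep (D) generic in (V, W) with `Graded n₁ V`, `Graded n₂ W`, `3 ≤ n₁ + n₂`»; this lineage's
N-d1leaf03g12-1).  For every located-pair term of the unfolding (part (A)): if both legs carry a difference it is admissible at weight degree 2;
if one leg carries none (then the other carries `≥ 3`) ONE summation by parts (part (C3)) writes its `tsum` as an admissible degree-2 term under the
shifted weight plus an admissible degree-1 term under the differenced weight; part (C2) bounds each uniformly in `n`; the term list is finite and fixed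
before `n`.
* §1 [folklore] the moment weights: `abs_moment_weight_le`, `abs_moment_weight_shift_le`, `abs_moment_weight_diff_le` (degree 2, 2, 1; constants 1, 1, 3).
* §2 [folklore] **`exists_bound_moment_term`** — one elementary term with unit steps and `3 ≤ len`: summable and `|fullSum (w_μw_ν·t.eval)| ≤ B`,
  `B` fixed before `n`, `g`, `μ`, `ν` (the three cases; by parts in the two degenerate ones).
* §3 [folklore] `exists_bound_moment_terms` (finite lists, `fullSum_add`), **`exists_bound_fullSum_moment_bub`**: `Graded n₁ V → Graded n₂ W →
  3 ≤ n₁ + n₂ → ∀ δ > 0, A₀ A₁ D₀ D₁ ≥ 0, ∃ A ≥ 0, ∀ n ≥ 1, ∀ g (four rows at scale n), ∀ μ ν`, the punctured partial sums of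
  `w ↦ w_μw_ν·bub g g V W (−w)` converge and `|fullSum| ≤ A`.
Unit `b2b-balaban-beta-d1-formalise-leaf-03` (gen 12), D1 formalisation swarm; `LEAVES-BFx.md` row «A3.c ∕ L-X TAILS» part (D).
-/

noncomputable section

namespace Summit.QuantumFields.BalabanUV.Beta.D1BFx.ScaleLegBubbles

open Filter Topology
open Literature.MathematicalPhysics.QuantumFieldTheory.Balaban1983to89
open Literature.MathematicalPhysics.QuantumFieldTheory.Balaban1983to89.Beta
open DyadicShell (Pt supNorm toReal toReal_apply supNorm_eq_zero_iff)
open BubbleTransfer (unitVec abs_moment_le)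
open GhostTable (gFree)
open BlockLegs (supNorm_add_le_real)
open WindowIdentification (psum fullSum fullSum_add fullSum_eq_tsum_sub fullSum_eq_of_tendsto exists_tendsto_psum_of_summable)
open GradedBubbles (Fam Stn bub Graded iterD IsStep supNorm_neg)
open GradedBubbleTerms (ETerm exists_eterms_of_graded)
open ScaleLegRows (abs_coord_le_supNorm supNorm_of_isStep)
open ScaleLegTermBound (exists_bound_weight_eval summable_weight_eval)
open ScaleLegByParts (tsum_weight_eval_nil_cons tsum_weight_eval_cons_nil)

/-! ## §1 The moment weights `w_μ w_ν`, their unit translates and differences -/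

section Weights

variable (μ ν : Fin 4)

/-- [folklore] `|w_μ w_ν| ≤ (‖w‖∞+1)²`. -/
theorem abs_moment_weight_le (w : Pt) : |toReal w μ * toReal w ν| ≤ 1 * ((supNorm w : ℝ) + 1) ^ 2 := by
  refine (abs_moment_le μ ν w).trans ?_
  have h0 : (0 : ℝ) ≤ supNorm w := Nat.cast_nonneg _
  nlinarith

/-- [folklore] `|(w+c)_μ (w+c)_ν| ≤ (‖w‖∞+1)²` for a unit step `c`. -/
theorem abs_moment_weight_shift_le {c : Pt} (hc : IsStep c) (w : Pt) : |toReal (w + c) μ * toReal (w + c) ν| ≤ 1 * ((supNorm w : ℝ) + 1) ^ 2 := by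
  refine (abs_moment_le μ ν (w + c)).trans ?_
  have h1 : (supNorm (w + c) : ℝ) ≤ supNorm w + 1 := by
    have h := supNorm_add_le_real w c
    rwa [supNorm_of_isStep hc] at h
  have h0 : (0 : ℝ) ≤ supNorm (w + c) := Nat.cast_nonneg _
  nlinarith

/-- [folklore] The DIFFERENCED weight has degree one: `|(w+c)_μ (w+c)_ν − w_μ w_ν| ≤ 3(‖w‖∞+1)` for a unit step `c`. -/
theorem abs_moment_weight_diff_le {c : Pt} (hc : IsStep c) (w : Pt) :
    |toReal (w + c) μ * toReal (w + c) ν - toReal w μ * toReal w ν| ≤ 3 * ((supNorm w : ℝ) + 1) ^ 1 := by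
  have hwμ := abs_coord_le_supNorm w μ
  have hwν := abs_coord_le_supNorm w ν
  have hcμ : |((c μ : ℤ) : ℝ)| ≤ 1 := by have h := abs_coord_le_supNorm c μ; rwa [supNorm_of_isStep hc] at h
  have hcν : |((c ν : ℤ) : ℝ)| ≤ 1 := by have h := abs_coord_le_supNorm c ν; rwa [supNorm_of_isStep hc] at h
  set s : ℝ := (supNorm w : ℝ)
  have hs0 : 0 ≤ s := Nat.cast_nonneg _
  have e : toReal (w + c) μ * toReal (w + c) ν - toReal w μ * toReal w ν =
      ((c μ : ℤ) : ℝ) * ((w ν : ℤ) : ℝ) + ((c ν : ℤ) : ℝ) * ((w μ : ℤ) : ℝ) + ((c μ : ℤ) : ℝ) * ((c ν : ℤ) : ℝ) := by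
    simp only [toReal_apply, Pi.add_apply, Int.cast_add]; ring
  rw [e, pow_one]
  have t1 : |((c μ : ℤ) : ℝ) * ((w ν : ℤ) : ℝ)| ≤ 1 * s := by rw [abs_mul]; exact mul_le_mul hcμ hwν (abs_nonneg _) zero_le_one
  have t2 : |((c ν : ℤ) : ℝ) * ((w μ : ℤ) : ℝ)| ≤ 1 * s := by rw [abs_mul]; exact mul_le_mul hcν hwμ (abs_nonneg _) zero_le_one
  have t3 : |((c μ : ℤ) : ℝ) * ((c ν : ℤ) : ℝ)| ≤ 1 * 1 := by rw [abs_mul]; exact mul_le_mul hcμ hcν (abs_nonneg _) zero_le_one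
  calc |((c μ : ℤ) : ℝ) * ((w ν : ℤ) : ℝ) + ((c ν : ℤ) : ℝ) * ((w μ : ℤ) : ℝ) + ((c μ : ℤ) : ℝ) * ((c ν : ℤ) : ℝ)|
      ≤ |((c μ : ℤ) : ℝ) * ((w ν : ℤ) : ℝ)| + |((c ν : ℤ) : ℝ) * ((w μ : ℤ) : ℝ)| + |((c μ : ℤ) : ℝ) * ((c ν : ℤ) : ℝ)| :=
        (abs_add_le _ _).trans (add_le_add (abs_add_le _ _) le_rfl)
    _ ≤ 1 * s + 1 * s + 1 * 1 := add_le_add (add_le_add t1 t2) t3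
    _ ≤ 3 * (s + 1) := by linarith

end Weights

/-! ## §2 One elementary term of total grading `≥ 3` under the moment weight -/

section OneTerm

variable {δ A₀ A₁ D₀ D₁ : ℝ}

/-- [folklore] **ONE ELEMENTARY TERM** `t` with unit steps and `3 ≤ |as₁| + |as₂|`: ONE `B ≥ 0`, fixed before the scale, with — for every `n ≥ 1`,
every profile `g` obeying d0∕d1∕h0∕h1 at scale `n`, every `μ, ν` — `w ↦ w_μw_ν·t.eval g g (w)` summable and `|fullSum| ≤ B`.  Both legs
differenced: admissible at degree 2 (part (C2)).  One leg undifferenced: ONE summation by parts (part (C3)); the two pieces are admissible at degrees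
2 and 1; `fullSum = Σ'` because the weight vanishes at the origin. -/
theorem exists_bound_moment_term (t : ETerm) (ht : ∀ a ∈ t.as₁ ++ t.as₂, IsStep a) (hlen : 3 ≤ t.len)
    (hδ : 0 < δ) (hA₀ : 0 ≤ A₀) (hA₁ : 0 ≤ A₁) (hD₀ : 0 ≤ D₀) (hD₁ : 0 ≤ D₁) :
    ∃ B : ℝ, 0 ≤ B ∧ ∀ (n : ℕ), 1 ≤ n → ∀ (g : Pt → ℝ),
      (∀ v : Pt, v ≠ 0 → |g v| ≤ A₀ * Real.exp (-(δ / n) * supNorm v) / (supNorm v : ℝ) ^ 2) →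
      (∀ v : Pt, v ≠ 0 → ∀ ρ : Fin 4, |g (v + unitVec ρ) - g v| ≤ A₁ * Real.exp (-(δ / n) * supNorm v) / (supNorm v : ℝ) ^ 3) →
      (∀ v : Pt, |g v - gFree v| ≤ D₀ / (n : ℝ) ^ 2) →
      (∀ (v : Pt) (ρ : Fin 4), |(g (v + unitVec ρ) - gFree (v + unitVec ρ)) - (g v - gFree v)| ≤ D₁ / (n : ℝ) ^ 3) →
      ∀ (μ ν : Fin 4),
        Summable (fun w : Pt => toReal w μ * toReal w ν * t.eval (fun _ _ => g) (fun _ _ => g) 0 0 w) ∧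
        |fullSum (fun w : Pt => toReal w μ * toReal w ν * t.eval (fun _ _ => g) (fun _ _ => g) 0 0 w)| ≤ B := by
  obtain ⟨c, x, y, as₁, as₂⟩ := t
  simp only [ETerm.len] at hlen
  -- the plain summability of the whole term (degree 2, any arity)
  have hsumAll : ∀ (n : ℕ), 1 ≤ n → ∀ (g : Pt → ℝ),
      (∀ v : Pt, v ≠ 0 → |g v| ≤ A₀ * Real.exp (-(δ / n) * supNorm v) / (supNorm v : ℝ) ^ 2) →
      (∀ v : Pt, v ≠ 0 → ∀ ρ : Fin 4, |g (v + unitVec ρ) - g v| ≤ A₁ * Real.exp (-(δ / n) * supNorm v) / (supNorm v : ℝ) ^ 3) →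
      (∀ v : Pt, |g v - gFree v| ≤ D₀ / (n : ℝ) ^ 2) → ∀ (μ ν : Fin 4) (t' : ETerm), (∀ a ∈ t'.as₁ ++ t'.as₂, IsStep a) →
      ∀ {P : Pt → ℝ} {Cp : ℝ} {m : ℕ}, m ≤ 2 → (∀ w : Pt, |P w| ≤ Cp * ((supNorm w : ℝ) + 1) ^ m) →
        Summable (fun w : Pt => P w * t'.eval (fun _ _ => g) (fun _ _ => g) 0 0 w) :=
    fun n hn g d0 d1 h0 μ ν t' ht' P Cp m hm hP => summable_weight_eval t' ht' hm hδ hA₀ hA₁ hn d0 d1 h0 hP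
  rcases as₁ with _ | ⟨a₁, as₁'⟩ <;> rcases as₂ with _ | ⟨a₂, as₂'⟩
  · -- both empty: impossible
    simp at hlen
  · -- (0, k): by parts on the second leg
    simp only [List.length_nil, List.length_cons, zero_add] at hlen
    have ht₁ : ∀ a ∈ ([a₂] : List Pt) ++ as₂', IsStep a := by
      intro a ha
      apply ht a
      simp only [List.mem_append, List.mem_cons, List.not_mem_nil, or_false, false_or] at ha ⊢
      exact ha
    have ht₀ : ∀ a ∈ ([] : List Pt) ++ as₂', IsStep a := by
      intro a ha
      apply ht a
      simp only [List.mem_append, List.mem_cons, List.not_mem_nil, false_or] at ha ⊢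
      exact Or.inr ha
    have ha₂ : IsStep a₂ := ht a₂ (by simp)
    obtain ⟨B₁, hB₁, h₁⟩ := exists_bound_weight_eval ⟨c, x, y, [a₂], as₂'⟩ ht₁ (m := 2) (by simp; omega) (by simp [ETerm.len]; omega) le_rfl
      (zero_le_one) hδ hA₀ hA₁ hD₀ hD₁
    obtain ⟨B₀, hB₀, h₀⟩ := exists_bound_weight_eval ⟨c, x, y, [], as₂'⟩ ht₀ (m := 1) (by simp; omega) (by simp [ETerm.len]; omega) (by norm_num)
      (by norm_num : (0 : ℝ) ≤ 3) hδ hA₀ hA₁ hD₀ hD₁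
    refine ⟨B₁ + B₀, by positivity, fun n hn g d0 d1 h0 h1 μ ν => ?_⟩
    set P : Pt → ℝ := fun w => toReal w μ * toReal w ν with hP
    have hPw : ∀ w : Pt, |P w| ≤ 1 * ((supNorm w : ℝ) + 1) ^ 2 := fun w => abs_moment_weight_le μ ν w
    have hneg : IsStep (-a₂) := ha₂.neg
    have hQ₁ : ∀ w : Pt, |P (w - a₂)| ≤ 1 * ((supNorm w : ℝ) + 1) ^ 2 := fun w => by
      rw [sub_eq_add_neg]; exact abs_moment_weight_shift_le μ ν hneg w
    have hQ₀ : ∀ w : Pt, |P (w - a₂) - P w| ≤ 3 * ((supNorm w : ℝ) + 1) ^ 1 := fun w => by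
      rw [sub_eq_add_neg]; exact abs_moment_weight_diff_le μ ν hneg w
    have hsum := hsumAll n hn g d0 d1 h0 μ ν ⟨c, x, y, [], a₂ :: as₂'⟩ ht le_rfl hPw
    obtain ⟨-, -, hT₁⟩ := h₁ n hn g d0 d1 h0 h1 (fun w => P (w - a₂)) hQ₁
    obtain ⟨-, -, hT₀⟩ := h₀ n hn g d0 d1 h0 h1 (fun w => P (w - a₂) - P w) hQ₀
    refine ⟨hsum, ?_⟩
    -- by parts (summability of the four pieces at fixed `n`)
    have hbp := tsum_weight_eval_nil_cons (g := g) (Q := P) (c := c) (x := x) (y := y) (a := a₂) (as := as₂')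
      (hsumAll n hn g d0 d1 h0 μ ν ⟨c, x, y + a₂, [], as₂'⟩ ht₀ le_rfl hPw)
      (hsumAll n hn g d0 d1 h0 μ ν ⟨c, x, y, [], as₂'⟩ ht₀ le_rfl hPw)
      (hsumAll n hn g d0 d1 h0 μ ν ⟨c, x, y, [a₂], as₂'⟩ ht₁ le_rfl hQ₁)
      (hsumAll n hn g d0 d1 h0 μ ν ⟨c, x, y, [], as₂'⟩ ht₀ (by norm_num) hQ₀)
    rw [fullSum_eq_tsum_sub _ hsum, hbp]
    have hz : P 0 * ETerm.eval (fun _ _ => g) (fun _ _ => g) ⟨c, x, y, [], a₂ :: as₂'⟩ 0 0 0 = 0 := by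
      rw [hP]; simp [toReal_apply]
    rw [hz, sub_zero]
    exact (abs_add_le _ _).trans (add_le_add hT₁ hT₀)
  · -- (k, 0): by parts on the first leg
    simp only [List.length_nil, List.length_cons, add_zero] at hlen
    have ht₁ : ∀ a ∈ as₁' ++ [a₁], IsStep a := by
      intro a ha
      apply ht a
      simp only [List.mem_append, List.mem_cons, List.not_mem_nil, or_false] at ha ⊢
      exact ha.symm
    have ht₀ : ∀ a ∈ as₁' ++ ([] : List Pt), IsStep a := by
      intro a ha
      apply ht a
      simp only [List.mem_append, List.mem_cons, List.not_mem_nil, or_false] at ha ⊢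
      exact Or.inr ha
    have ha₁ : IsStep a₁ := ht a₁ (by simp)
    obtain ⟨B₁, hB₁, h₁⟩ := exists_bound_weight_eval ⟨c, x, y, as₁', [a₁]⟩ ht₁ (m := 2) (by simp; omega) (by simp [ETerm.len]; omega) le_rfl
      (zero_le_one) hδ hA₀ hA₁ hD₀ hD₁
    obtain ⟨B₀, hB₀, h₀⟩ := exists_bound_weight_eval ⟨c, x, y, as₁', []⟩ ht₀ (m := 1) (by simp; omega) (by simp [ETerm.len]; omega) (by norm_num)
      (by norm_num : (0 : ℝ) ≤ 3) hδ hA₀ hA₁ hD₀ hD₁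
    refine ⟨B₁ + B₀, by positivity, fun n hn g d0 d1 h0 h1 μ ν => ?_⟩
    set P : Pt → ℝ := fun w => toReal w μ * toReal w ν with hP
    have hPw : ∀ w : Pt, |P w| ≤ 1 * ((supNorm w : ℝ) + 1) ^ 2 := fun w => abs_moment_weight_le μ ν w
    have hQ₁ : ∀ w : Pt, |P (w + a₁)| ≤ 1 * ((supNorm w : ℝ) + 1) ^ 2 := fun w => abs_moment_weight_shift_le μ ν ha₁ w
    have hQ₀ : ∀ w : Pt, |P w - P (w + a₁)| ≤ 3 * ((supNorm w : ℝ) + 1) ^ 1 := fun w => by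
      rw [abs_sub_comm]; exact abs_moment_weight_diff_le μ ν ha₁ w
    have hsum := hsumAll n hn g d0 d1 h0 μ ν ⟨c, x, y, a₁ :: as₁', []⟩ ht le_rfl hPw
    obtain ⟨-, -, hT₁⟩ := h₁ n hn g d0 d1 h0 h1 (fun w => P (w + a₁)) hQ₁
    obtain ⟨-, -, hT₀⟩ := h₀ n hn g d0 d1 h0 h1 (fun w => P w - P (w + a₁)) hQ₀
    refine ⟨hsum, ?_⟩
    have hbp := tsum_weight_eval_cons_nil (g := g) (Q := P) (c := c) (x := x) (y := y) (a := a₁) (as := as₁')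
      (hsumAll n hn g d0 d1 h0 μ ν ⟨c, x, y + a₁, as₁', []⟩ ht₀ le_rfl hQ₁)
      (hsumAll n hn g d0 d1 h0 μ ν ⟨c, x, y, as₁', []⟩ ht₀ le_rfl hQ₁)
      hsum
      (hsumAll n hn g d0 d1 h0 μ ν ⟨c, x, y, as₁', []⟩ ht₀ (by norm_num) hQ₀)
    rw [fullSum_eq_tsum_sub _ hsum, hbp]
    have hz : P 0 * ETerm.eval (fun _ _ => g) (fun _ _ => g) ⟨c, x, y, a₁ :: as₁', []⟩ 0 0 0 = 0 := by
      rw [hP]; simp [toReal_apply]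
    rw [hz, sub_zero]
    exact (abs_sub _ _).trans (add_le_add hT₁ hT₀)
  · -- both legs differenced: admissible at degree 2
    simp only [List.length_cons] at hlen
    obtain ⟨B, hB, h⟩ := exists_bound_weight_eval ⟨c, x, y, a₁ :: as₁', a₂ :: as₂'⟩ ht (m := 2) (by simp) (by simp [ETerm.len]; omega) le_rfl
      (zero_le_one) hδ hA₀ hA₁ hD₀ hD₁
    refine ⟨B, hB, fun n hn g d0 d1 h0 h1 μ ν => ?_⟩
    obtain ⟨hs, hf, -⟩ := h n hn g d0 d1 h0 h1 (fun w => toReal w μ * toReal w ν) (fun w => abs_moment_weight_le μ ν w)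
    exact ⟨hs, hf⟩

end OneTerm

/-! ## §3 Finite lists of terms; the graded bubble -/

section Lists

variable {δ A₀ A₁ D₀ D₁ : ℝ}

/-- [folklore] **A FINITE LIST OF TERMS** (each with unit steps and total grading `≥ 3`): ONE bound for the full sum of the weighted list sum,
uniformly in the scale (induction on the list, `WindowIdentification.fullSum_add`). -/
theorem exists_bound_moment_terms (Lst : List ETerm) (hL : ∀ t ∈ Lst, (∀ a ∈ t.as₁ ++ t.as₂, IsStep a) ∧ 3 ≤ t.len)
    (hδ : 0 < δ) (hA₀ : 0 ≤ A₀) (hA₁ : 0 ≤ A₁) (hD₀ : 0 ≤ D₀) (hD₁ : 0 ≤ D₁) :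
    ∃ A : ℝ, 0 ≤ A ∧ ∀ (n : ℕ), 1 ≤ n → ∀ (g : Pt → ℝ),
      (∀ v : Pt, v ≠ 0 → |g v| ≤ A₀ * Real.exp (-(δ / n) * supNorm v) / (supNorm v : ℝ) ^ 2) →
      (∀ v : Pt, v ≠ 0 → ∀ ρ : Fin 4, |g (v + unitVec ρ) - g v| ≤ A₁ * Real.exp (-(δ / n) * supNorm v) / (supNorm v : ℝ) ^ 3) →
      (∀ v : Pt, |g v - gFree v| ≤ D₀ / (n : ℝ) ^ 2) →
      (∀ (v : Pt) (ρ : Fin 4), |(g (v + unitVec ρ) - gFree (v + unitVec ρ)) - (g v - gFree v)| ≤ D₁ / (n : ℝ) ^ 3) →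
      ∀ (μ ν : Fin 4),
        Summable (fun w : Pt => (Lst.map fun t => toReal w μ * toReal w ν * t.eval (fun _ _ => g) (fun _ _ => g) 0 0 w).sum) ∧
        |fullSum (fun w : Pt => (Lst.map fun t => toReal w μ * toReal w ν * t.eval (fun _ _ => g) (fun _ _ => g) 0 0 w).sum)| ≤ A := by
  induction Lst with
  | nil =>
      refine ⟨0, le_rfl, fun n hn g d0 d1 h0 h1 μ ν => ?_⟩
      simp only [List.map_nil, List.sum_nil]
      refine ⟨summable_zero, ?_⟩
      have h0 : fullSum (fun _ : Pt => (0 : ℝ)) = 0 := by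
        refine fullSum_eq_of_tendsto ?_
        have : psum (fun _ : Pt => (0 : ℝ)) = fun _ => 0 := by funext R; simp [psum]
        rw [this]; exact tendsto_const_nhds
      rw [h0, abs_zero]
  | cons t Lst ih =>
      obtain ⟨A, hA, hrest⟩ := ih (fun t' ht' => hL t' (List.mem_cons_of_mem t ht'))
      obtain ⟨B, hB, hterm⟩ := exists_bound_moment_term t (hL t (by simp)).1 (hL t (by simp)).2 hδ hA₀ hA₁ hD₀ hD₁
      refine ⟨B + A, by positivity, fun n hn g d0 d1 h0 h1 μ ν => ?_⟩
      obtain ⟨hs₁, hb₁⟩ := hterm n hn g d0 d1 h0 h1 μ ν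
      obtain ⟨hs₂, hb₂⟩ := hrest n hn g d0 d1 h0 h1 μ ν
      simp only [List.map_cons, List.sum_cons]
      refine ⟨hs₁.add hs₂, ?_⟩
      rw [fullSum_add (exists_tendsto_psum_of_summable _ hs₁) (exists_tendsto_psum_of_summable _ hs₂)]
      exact (abs_add_le _ _).trans (add_le_add hb₁ hb₂)

/-- [folklore] **THE TWO-REGIME DECAY THEOREM (the tail module's headline).**  For graded stencils `Graded n₁ V`, `Graded n₂ W` with
`3 ≤ n₁ + n₂`, and row constants `δ > 0`, `A₀, A₁, D₀, D₁ ≥ 0`, there is ONE `A ≥ 0` such that for every scale `n ≥ 1`, every profile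
`g : ℤ⁴ → ℝ` obeying at scale `n` the END's four rows — d0 `|g v| ≤ A₀e^{−(δ/n)‖v‖∞}/‖v‖∞²`, d1 `|g(v+e_ρ) − g v| ≤ A₁e^{−(δ/n)‖v‖∞}/‖v‖∞³`
(`v ≠ 0`), h0 `|g − gFree| ≤ D₀/n²`, h1 `|∂_ρ(g − gFree)| ≤ D₁/n³` — and every `μ, ν`: the punctured partial sums of
`w ↦ w_μw_ν·bub g g V W (−w)` converge and `|fullSum (w ↦ w_μw_ν·bub g g V W (−w))| ≤ A`.  (an3's `sum_abs_moment_le ∘ isO_seven` asked instead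
for the uniform budget `DG 3 2`; NO shell row and NO third difference is used here.) -/
theorem exists_bound_fullSum_moment_bub {I : Type*} [Fintype I] {n₁ n₂ : ℕ} {V W : Stn I} (hV : Graded n₁ V) (hW : Graded n₂ W)
    (h3 : 3 ≤ n₁ + n₂) (hδ : 0 < δ) (hA₀ : 0 ≤ A₀) (hA₁ : 0 ≤ A₁) (hD₀ : 0 ≤ D₀) (hD₁ : 0 ≤ D₁) :
    ∃ A : ℝ, 0 ≤ A ∧ ∀ (n : ℕ), 1 ≤ n → ∀ (g : Pt → ℝ),
      (∀ v : Pt, v ≠ 0 → |g v| ≤ A₀ * Real.exp (-(δ / n) * supNorm v) / (supNorm v : ℝ) ^ 2) →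
      (∀ v : Pt, v ≠ 0 → ∀ ρ : Fin 4, |g (v + unitVec ρ) - g v| ≤ A₁ * Real.exp (-(δ / n) * supNorm v) / (supNorm v : ℝ) ^ 3) →
      (∀ v : Pt, |g v - gFree v| ≤ D₀ / (n : ℝ) ^ 2) →
      (∀ (v : Pt) (ρ : Fin 4), |(g (v + unitVec ρ) - gFree (v + unitVec ρ)) - (g v - gFree v)| ≤ D₁ / (n : ℝ) ^ 3) →
      ∀ (μ ν : Fin 4),
        (∃ B : ℝ, Tendsto (psum (fun w : Pt => toReal w μ * toReal w ν * bub (fun _ _ => g) (fun _ _ => g) V W 0 0 (-w))) atTop (𝓝 B)) ∧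
        |fullSum (fun w : Pt => toReal w μ * toReal w ν * bub (fun _ _ => g) (fun _ _ => g) V W 0 0 (-w))| ≤ A := by
  obtain ⟨Lst, hL, hid⟩ := exists_eterms_of_graded hV hW
  -- the swapped list (reflection `w ↦ −w` = leg swap), same steps and lengths
  have hL' : ∀ t ∈ Lst.map ETerm.swap, (∀ a ∈ t.as₁ ++ t.as₂, IsStep a) ∧ 3 ≤ t.len := by
    intro t ht
    obtain ⟨t₀, ht₀, rfl⟩ := List.mem_map.mp ht
    exact ⟨ETerm.steps_swap (hL t₀ ht₀).1, by rw [ETerm.len_swap]; exact le_trans h3 (hL t₀ ht₀).2⟩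
  obtain ⟨A, hA, h⟩ := exists_bound_moment_terms (Lst.map ETerm.swap) hL' hδ hA₀ hA₁ hD₀ hD₁
  refine ⟨A, hA, fun n hn g d0 d1 h0 h1 μ ν => ?_⟩
  have e : (fun w : Pt => toReal w μ * toReal w ν * bub (fun _ _ => g) (fun _ _ => g) V W 0 0 (-w)) =
      fun w : Pt => ((Lst.map ETerm.swap).map fun t => toReal w μ * toReal w ν * t.eval (fun _ _ => g) (fun _ _ => g) 0 0 w).sum := by
    funext w
    rw [hid (fun _ _ => g) (fun _ _ => g) 0 0 (-w), List.map_map, ← List.sum_map_mul_left]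
    congr 1
    refine List.map_congr_left fun t _ => ?_
    simp only [Function.comp_apply, ETerm.eval_neg_eq_eval_swap]
  obtain ⟨hs, hb⟩ := h n hn g d0 d1 h0 h1 μ ν
  rw [e]
  exact ⟨exists_tendsto_psum_of_summable _ hs, hb⟩

end Lists

end Summit.QuantumFields.BalabanUV.Beta.D1BFx.ScaleLegBubbles

end
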